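import Mathlib
import HarnessLib
import Literature.Analysis.SpecialFunctions.LogChooseStirling
import Summits.KontsevichZagierPeriods.Zeta5Search.Denom.TwoTaleR3Forms
import Summits.KontsevichZagierPeriods.Zeta5Search.TwoTaleP15Growth

/-!
# TwoTaleR3Growth — the coefficient rate at RUNG A `(6,5,4,7 | 0,1,2,12)`: Whipple's partner is a one-signed sum

HONEST FRAMING: systematic search; no irrationality claim unless certified.

fam-measure (pub-zeta5), `families/measure/FAMILY.md` §10.5 (the (bmiss)-FREE ladder rung A) and §10.10.  The tree
file `Denom/TwoTaleR3Forms` (fam-denom) packages the conditional measure at Zudilin's Remark-3 point in its CONE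
pairing, `a = (6n+1, 5n+1, 4n+1, 7n+1)`, `b = (1, n+1, 2n+1, 12n+2)`, as
`InclusionA → DecayA c → CoeffRateA C₁ → 14 − S < c → 0 < C₁ → ExponentLE (zetaValue 2) (1 + (C₁ + 14 − S)/(c − 14 + S))`
with the growth input `CoeffRateA C₁ : Tendsto (log |formQA n| / n) (𝓝 C₁)` NOT proved (model `C₁ = 18.75527331…`).
This file and its sequels `TwoTaleR3GrowthLimit`, `TwoTaleR3GrowthEnclosure` are the rung-A port of the P15
development `TwoTaleP15Growth{,Limit,Enclosure}` (same six lemmas, new slopes): NO recurrence and NO saddle point —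

* on the two-tale cone `q_n = −q̂_n` is **Whipple's terminating transformation** [Bailey 1935, §4.5 (1); Zudilin,
  arXiv:1310.1526 §6 and Remark 5; arXiv:1611.08806 eq. (11)], a PRINTED classical theorem; at rung A it reads
  `formQA n = −qhatA n` with the EXPLICIT partner sum `qhatA n = Σ_k termA n k` at the Remark-5 partner parameters
  `â = (15n+2; 5n+1, 6n+1, 7n+1)`, `b̂ = (7n+2; 3n+1, 11n+2, 12n+2)` — recorded as the named input `WhippleA` (not proved
  in the tree; `formQA n = −qhatA n` was checked exactly for `n ≤ 6` against the tree's definitions, and `qhatA n`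
  equals the Literature's `Zudilin2014.formQTZ â b̂` at those `n`; `qhatA 1 = 2504250` is checked by `decide`);
* the summands are ONE-SIGNED BY FORMULA: `termA n k = C(2k−7n−2, 8n)·C(k−3n−1, 2n)·C(5n, k−6n−1)·C(5n, k−7n−1) ≥ 0`
  (Zudilin's `A_k`, arXiv:1310.1526 §6 eq. (T2)), so `max_k ≤ qhatA n ≤ (5n+1)·max_k`;
* THIS PART: the partner sum, the tangent slopes `sᵢ(u)` (`u = k/n ∈ (15/2, 11)`), the affine Chernoff exponent
  `n·Λ(u) + k·G(u) + K₀(u)`, the critical abscissa `ustarA ∈ [9, 21/2]` with `slopeGA ustarA = 0` (IVT from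
  `slopeGA 9 > 0 > slopeGA (21/2) = log(35/99)`; numerically `ustarA = 10.1680254…`), `C₁starA := rateΛA ustarA`
  (numerically `18.7552733…`) and the upper bound `qhatA_le`; the generic Chernoff lemmas are those of
  `TwoTaleP15Growth` (`choose_le_exp`, `exp_le_choose`, `prod4_le`).

NOTHING here certifies a measure: `InclusionA`, `DecayA` (fam-denom) and `WhippleA` remain named inputs.
References: W. N. Bailey, Generalized hypergeometric series (1935) §4.5; W. Zudilin, arXiv:1310.1526 [Zudilin2014ZetaTwo]
§6, Remarks 3 and 5; W. Zudilin, arXiv:1611.08806 §3 eq. (10)–(11).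
-/

noncomputable section

open Filter Topology Finset Real

namespace Summit.KontsevichZagierPeriods.Zeta5Search.TwoTaleR3Growth

open Summit.KontsevichZagierPeriods.Zeta5Search.Denom.TwoTaleR3Forms (formQA CoeffRateA)
open Summit.KontsevichZagierPeriods.Zeta5Search.TwoTaleP15Growth (choose_le_exp exp_le_choose prod4_le)

/-! ### The partner sum (tale 2 at the Remark-5 parameters of rung A) -/

/-- Zudilin's `A_k` (arXiv:1310.1526 §6, eq. (T2)) at the rung-A partner: the product of four binomials
`C(2k−7n−2, 8n)·C(k−3n−1, 2n)·C(5n, k−6n−1)·C(5n, k−7n−1)` — a natural number, nonzero exactly for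
`⌈15n/2⌉+1 ≤ k ≤ 11n+1` (inside the summation window `7n+1 ≤ k ≤ 12n+1` no truncated subtraction occurs). -/
def termA (n k : ℕ) : ℕ :=
  Nat.choose (2 * k - (7 * n + 2)) (8 * n) * Nat.choose (k - (3 * n + 1)) (2 * n) *
    Nat.choose (5 * n) (k - (6 * n + 1)) * Nat.choose (5 * n) (k - (7 * n + 1))

/-- `qhatA n = Σ_{k=7n+1}^{12n+1} A_k = |q̂_n|` (the global sign `(−1)^{b̂₂+b̂₃}` and the sign of eq. (T2) cancel:
`qhatA n = Zudilin2014.formQTZ â b̂ ≥ 0`). -/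
def qhatA (n : ℕ) : ℕ := ∑ k ∈ Ico (7 * n + 1) (12 * n + 2), termA n k

/-- Kernel sanity value: `qhatA 1 = 2504250 = −formQA 1`. -/
theorem qhatA_one : qhatA 1 = 2504250 := by
  decide +kernel

/-- **INPUT (PRINTED THEOREM, not yet a tree theorem) — Whipple at rung A.**  `q_n = −q̂_n` for all `n ≥ 1`:
the terminating Whipple transformation between the very-well-poised second tale and the Saalschützian first tale
[Bailey 1935 §4.5 (1)], specialised along Zudilin's Remark 5 (arXiv:1310.1526) to `(6,5,4,7 | 0,1,2,12)`.
Verified exactly for `n ≤ 6` against `Zudilin2014.formQZ (aRungA n) (bRungA n)` (fam-measure g3,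
`rungA_whipple_check.py`). -/
@[conjecture] def WhippleA : Prop :=
  ∀ n : ℕ, 1 ≤ n → formQA n = -((qhatA n : ℕ) : ℤ)

/-! ### The tangent slopes and the affine exponent -/

/-- Slope of the block `C(2k−7n−2, 8n)` at abscissa `u = k/n`: `s₀ = 8/(2u−7)`. -/
def s₀ (u : ℝ) : ℝ := 8 / (2 * u - 7)
/-- Slope of `C(k−3n−1, 2n)`: `s₁ = 2/(u−3)`. -/
def s₁ (u : ℝ) : ℝ := 2 / (u - 3)
/-- Slope of `C(5n, k−6n−1)`: `s₂ = (u−6)/5`. -/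
def s₂ (u : ℝ) : ℝ := (u - 6) / 5
/-- Slope of `C(5n, k−7n−1)`: `s₃ = (u−7)/5`. -/
def s₃ (u : ℝ) : ℝ := (u - 7) / 5

/-- The `n`-coefficient `Λ(u)` of the total Chernoff exponent at slopes `sᵢ(u)`. -/
def rateΛA (u : ℝ) : ℝ :=
  -8 * Real.log (s₀ u) + 15 * Real.log (1 - s₀ u) - 2 * Real.log (s₁ u) + 5 * Real.log (1 - s₁ u) +
    6 * Real.log (s₂ u) - 11 * Real.log (1 - s₂ u) + 7 * Real.log (s₃ u) - 12 * Real.log (1 - s₃ u)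

/-- The `k`-coefficient `G(u)` of the total Chernoff exponent (`= h′(u)`, the derivative of the max-term entropy):
`G(u) = 2 log((2u−7)/(2u−15)) + log((u−3)/(u−5)) + log((11−u)/(u−6)) + log((12−u)/(u−7))`. -/
def slopeGA (u : ℝ) : ℝ :=
  -2 * Real.log (1 - s₀ u) - Real.log (1 - s₁ u) - Real.log (s₂ u) + Real.log (1 - s₂ u) - Real.log (s₃ u) +
    Real.log (1 - s₃ u)

/-- The constant term `K₀(u)` of the total Chernoff exponent (from the `−2, −1, −1, −1` offsets). -/
def constKA (u : ℝ) : ℝ :=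
  2 * Real.log (1 - s₀ u) + Real.log (1 - s₁ u) + Real.log (s₂ u) - Real.log (1 - s₂ u) + Real.log (s₃ u) -
    Real.log (1 - s₃ u)

/-- The four Chernoff exponents add up to the AFFINE form `n·Λ(u) + k·G(u) + K₀(u)`. -/
theorem affine_eq (u : ℝ) (n k : ℝ) :
    (8 * n * (-Real.log (s₀ u)) + (2 * k - 7 * n - 2 - 8 * n) * (-Real.log (1 - s₀ u))) +
      (2 * n * (-Real.log (s₁ u)) + (k - 3 * n - 1 - 2 * n) * (-Real.log (1 - s₁ u))) +
      ((k - 6 * n - 1) * (-Real.log (s₂ u)) + (5 * n - (k - 6 * n - 1)) * (-Real.log (1 - s₂ u))) +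
      ((k - 7 * n - 1) * (-Real.log (s₃ u)) + (5 * n - (k - 7 * n - 1)) * (-Real.log (1 - s₃ u))) =
    n * rateΛA u + k * slopeGA u + constKA u := by
  unfold rateΛA slopeGA constKA; ring

/-- The slopes lie in `(0,1)` for `15/2 < u < 11`. -/
theorem slopes_mem {u : ℝ} (hu : 15 / 2 < u) (hu' : u < 11) :
    (0 < s₀ u ∧ s₀ u < 1) ∧ (0 < s₁ u ∧ s₁ u < 1) ∧ (0 < s₂ u ∧ s₂ u < 1) ∧ (0 < s₃ u ∧ s₃ u < 1) := by
  unfold s₀ s₁ s₂ s₃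
  have h7 : 0 < 2 * u - 7 := by linarith
  have h3 : 0 < u - 3 := by linarith
  have h6 : 0 < u - 6 := by linarith
  have h7' : 0 < u - 7 := by linarith
  refine ⟨⟨by positivity, ?_⟩, ⟨by positivity, ?_⟩, ⟨by positivity, ?_⟩, ⟨by positivity, ?_⟩⟩
  · rw [div_lt_one h7]; linarith
  · rw [div_lt_one h3]; linarith
  · rw [div_lt_one (by norm_num : (0:ℝ) < 5)]; linarith
  · rw [div_lt_one (by norm_num : (0:ℝ) < 5)]; linarith

/-! ### Upper half: every summand is below the tangent plane -/

/-- **Tangent-plane bound**: for `7n+1 ≤ k` and `15/2 < u < 11`, `termA n k ≤ exp(n·Λ(u) + k·G(u) + K₀(u))`. -/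
theorem termA_le_exp (n k : ℕ) (hk : 7 * n + 1 ≤ k) {u : ℝ} (hu : 15 / 2 < u) (hu' : u < 11) :
    (termA n k : ℝ) ≤ Real.exp (n * rateΛA u + k * slopeGA u + constKA u) := by
  obtain ⟨⟨a0, b0⟩, ⟨a1, b1⟩, ⟨a2, b2⟩, ⟨a3, b3⟩⟩ := slopes_mem hu hu'
  have e0 : ((2 * k - (7 * n + 2) : ℕ) : ℝ) = 2 * k - 7 * n - 2 := by
    rw [Nat.cast_sub (by omega)]; push_cast; ring
  have e1 : ((k - (3 * n + 1) : ℕ) : ℝ) = k - 3 * n - 1 := by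
    rw [Nat.cast_sub (by omega)]; push_cast; ring
  have e2 : ((k - (6 * n + 1) : ℕ) : ℝ) = k - 6 * n - 1 := by
    rw [Nat.cast_sub (by omega)]; push_cast; ring
  have e3 : ((k - (7 * n + 1) : ℕ) : ℝ) = k - 7 * n - 1 := by
    rw [Nat.cast_sub (by omega)]; push_cast; ring
  have g0 := choose_le_exp (2 * k - (7 * n + 2)) (8 * n) a0 b0
  have g1 := choose_le_exp (k - (3 * n + 1)) (2 * n) a1 b1
  have g2 := choose_le_exp (5 * n) (k - (6 * n + 1)) a2 b2
  have g3 := choose_le_exp (5 * n) (k - (7 * n + 1)) a3 b3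
  rw [e0] at g0; rw [e1] at g1; rw [e2] at g2; rw [e3] at g3
  unfold termA
  push_cast
  refine (prod4_le (by positivity) (by positivity) (by positivity) (by positivity) g0 g1 g2 g3).trans (le_of_eq ?_)
  rw [← Real.exp_add, ← Real.exp_add, ← Real.exp_add]
  congr 1
  rw [← affine_eq u n k]
  push_cast
  ring

/-! ### The critical abscissa `ustarA`: the root of `slopeGA` -/

/-- `slopeGA` is continuous at every `u ∈ (15/2, 11)`. -/
theorem slopeGA_continuousAt {u : ℝ} (hu : 15 / 2 < u) (hu' : u < 11) : ContinuousAt slopeGA u := by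
  obtain ⟨⟨a0, b0⟩, ⟨a1, b1⟩, ⟨a2, b2⟩, ⟨a3, b3⟩⟩ := slopes_mem hu hu'
  unfold s₀ at a0 b0; unfold s₁ at a1 b1; unfold s₂ at a2 b2; unfold s₃ at a3 b3
  have h1 : (2 * u - 7) ≠ 0 := (by linarith : (0:ℝ) < 2 * u - 7).ne'
  have h2 : u - 3 ≠ 0 := (by linarith : (0:ℝ) < u - 3).ne'
  have h3 : 1 - 8 / (2 * u - 7) ≠ 0 := (by linarith : (0:ℝ) < 1 - 8 / (2 * u - 7)).ne'
  have h4 : 1 - 2 / (u - 3) ≠ 0 := (by linarith : (0:ℝ) < 1 - 2 / (u - 3)).ne'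
  have h5 : (u - 6) / 5 ≠ 0 := a2.ne'
  have h6 : 1 - (u - 6) / 5 ≠ 0 := (by linarith : (0:ℝ) < 1 - (u - 6) / 5).ne'
  have h7 : (u - 7) / 5 ≠ 0 := a3.ne'
  have h8 : 1 - (u - 7) / 5 ≠ 0 := (by linarith : (0:ℝ) < 1 - (u - 7) / 5).ne'
  unfold slopeGA s₀ s₁ s₂ s₃
  fun_prop (disch := assumption)

/-- `slopeGA 9 > 0` (`= −2 log(3/11) − log(2/3)`, the last four terms cancel). -/
theorem slopeGA_left_pos : 0 < slopeGA 9 := by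
  have h1 : Real.log (3 / 11) < 0 := Real.log_neg (by norm_num) (by norm_num)
  have h2 : Real.log (2 / 3) < 0 := Real.log_neg (by norm_num) (by norm_num)
  have e : slopeGA 9 = -2 * Real.log (3 / 11) - Real.log (2 / 3) - Real.log (3 / 5) + Real.log (2 / 5) -
      Real.log (2 / 5) + Real.log (3 / 5) := by
    unfold slopeGA s₀ s₁ s₂ s₃; norm_num
  rw [e]; linarith

/-- `slopeGA (21/2) < 0`: at `u = 21/2` the slopes are `4/7, 4/15, 9/10, 7/10` and the six logarithms collapse to
`log 35 − log 99 < 0`. -/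
theorem slopeGA_right_neg : slopeGA (21 / 2) < 0 := by
  have e : slopeGA (21 / 2) = -2 * Real.log (3 / 7) - Real.log (11 / 15) - Real.log (9 / 10) +
      Real.log (1 / 10) - Real.log (7 / 10) + Real.log (3 / 10) := by
    unfold slopeGA s₀ s₁ s₂ s₃; norm_num
  have d1 : Real.log (3 / 7) = Real.log 3 - Real.log 7 := Real.log_div (by norm_num) (by norm_num)
  have d2 : Real.log (11 / 15) = Real.log 11 - Real.log 15 := Real.log_div (by norm_num) (by norm_num)
  have d3 : Real.log (9 / 10) = Real.log 9 - Real.log 10 := Real.log_div (by norm_num) (by norm_num)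
  have d4 : Real.log (1 / 10) = Real.log 1 - Real.log 10 := Real.log_div (by norm_num) (by norm_num)
  have d5 : Real.log (7 / 10) = Real.log 7 - Real.log 10 := Real.log_div (by norm_num) (by norm_num)
  have d6 : Real.log (3 / 10) = Real.log 3 - Real.log 10 := Real.log_div (by norm_num) (by norm_num)
  have m15 : Real.log 15 = Real.log 3 + Real.log 5 := by
    rw [show (15:ℝ) = 3 * 5 by norm_num, Real.log_mul (by norm_num) (by norm_num)]
  have m9 : Real.log 9 = 2 * Real.log 3 := by
    rw [show (9:ℝ) = 3 ^ 2 by norm_num, Real.log_pow]; norm_num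
  have m35 : Real.log 35 = Real.log 5 + Real.log 7 := by
    rw [show (35:ℝ) = 5 * 7 by norm_num, Real.log_mul (by norm_num) (by norm_num)]
  have m99 : Real.log 99 = 2 * Real.log 3 + Real.log 11 := by
    rw [show (99:ℝ) = 3 ^ 2 * 11 by norm_num, Real.log_mul (by norm_num) (by norm_num), Real.log_pow]; norm_num
  have hlt : Real.log 35 < Real.log 99 := Real.log_lt_log (by norm_num) (by norm_num)
  rw [e, d1, d2, d3, d4, d5, d6, Real.log_one]
  linarith

/-- **IVT**: `slopeGA` has a zero in `[9, 21/2]`. -/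
theorem exists_root : ∃ u ∈ Set.Icc (9:ℝ) (21 / 2), slopeGA u = 0 := by
  have hcont : ContinuousOn slopeGA (Set.Icc (9:ℝ) (21 / 2)) := fun u hu =>
    (slopeGA_continuousAt (by linarith [hu.1]) (by linarith [hu.2])).continuousWithinAt
  have h := intermediate_value_Icc' (by norm_num : (9:ℝ) ≤ 21 / 2) hcont
  have h0 : (0:ℝ) ∈ Set.Icc (slopeGA (21 / 2)) (slopeGA 9) := ⟨slopeGA_right_neg.le, slopeGA_left_pos.le⟩
  obtain ⟨u, hu, hu0⟩ := h h0
  exact ⟨u, hu, hu0⟩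

/-- The critical abscissa `u* ∈ [9, 21/2]` with `G(u*) = 0` (numerically `u* = 10.1680254…`, the relevant root of
`(2u−7)²(u−3)(11−u)(12−u) = (2u−15)²(u−5)(u−6)(u−7)`). -/
def ustarA : ℝ := exists_root.choose

/-- The defining property of `ustarA`: it lies in `[9, 21/2]` and `slopeGA ustarA = 0`. -/
theorem ustarA_spec : ustarA ∈ Set.Icc (9:ℝ) (21 / 2) ∧ slopeGA ustarA = 0 := exists_root.choose_spec

/-- `ustarA` lies in the open window `(15/2, 11)` where all four slopes are in `(0, 1)`. -/
theorem ustarA_bounds : 15 / 2 < ustarA ∧ ustarA < 11 :=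
  ⟨by linarith [ustarA_spec.1.1], by linarith [ustarA_spec.1.2]⟩

/-- **The coefficient rate** `C₁* = Λ(u*)` at rung A: the height of the horizontal tangent plane of the max-term
entropy (numerically `18.7552733…`; the enclosure `≤ 18.7553` is `TwoTaleR3GrowthEnclosure.C₁starA_le`). -/
def C₁starA : ℝ := rateΛA ustarA

/-- The bounded penalty constant of the reverse-Chernoff step at `k_n = ⌊u* n⌋`. -/
def penPA : ℝ :=
  9 / (s₀ ustarA * (1 - s₀ ustarA)) + 1 / (s₁ ustarA * (1 - s₁ ustarA)) + 4 / (s₂ ustarA * (1 - s₂ ustarA)) +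
    4 / (s₃ ustarA * (1 - s₃ ustarA))

/-! ### Upper bound for `qhatA` -/

/-- **Upper half**: `qhatA n ≤ (5n+1)·exp(n·C₁* + K₀(u*))` for every `n`. -/
theorem qhatA_le (n : ℕ) : (qhatA n : ℝ) ≤ (5 * n + 1) * Real.exp (n * C₁starA + constKA ustarA) := by
  obtain ⟨hu1, hu2⟩ := ustarA_bounds
  have hG := ustarA_spec.2
  have hc : (Ico (7 * n + 1) (12 * n + 2)).card = 5 * n + 1 := by simp; omega
  unfold qhatA
  push_cast
  calc ∑ k ∈ Ico (7 * n + 1) (12 * n + 2), (termA n k : ℝ)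
      ≤ ∑ k ∈ Ico (7 * n + 1) (12 * n + 2), Real.exp (n * C₁starA + constKA ustarA) := by
        apply Finset.sum_le_sum
        intro k hk
        have hk1 : 7 * n + 1 ≤ k := (Finset.mem_Ico.mp hk).1
        have h := termA_le_exp n k hk1 hu1 hu2
        rw [hG, mul_zero, add_zero] at h
        exact h
    _ = (5 * n + 1) * Real.exp (n * C₁starA + constKA ustarA) := by
        rw [Finset.sum_const, hc, nsmul_eq_mul]; push_cast; ring

end Summit.KontsevichZagierPeriods.Zeta5Search.TwoTaleR3Growth

end
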